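import Literature.MathematicalPhysics.QuantumLattice.HubbardTTPrimeDoccTransportThermal
import HarnessLib

/-!
# Cap-class certificate transport on a `(t', U)` CELL from the caps of its TOP CORNERS at positive
# temperature (the joint form of the thermal far-column rule; the `U`-extent above the anchor row is free)

Family `hubbard` (topic `MathematicalPhysics/QuantumLattice`); written for stage S2 of the Hubbard
material-oracle programme (cell `pub/hubbard-downfold`, seat `hubbard-downfold-unc-3`), the `T > 0` twin of
seat `hubbard-box-p3`'s `HubbardTTPrimeFarCornerCapTransport` and the joint `(t', U)` companion of
`HubbardTTPrimeTwoColumnCapTransportThermal` (the `t'`-cell at fixed `U`) and of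
`HubbardTTPrimeDoccTransportThermal` §4 (ONE anchor `(s₀, U₀)`: kinematic booking
`u₀ + 2H_b(n/2)/β + (32/π²)·max|Δs| + (n/2 − max(0,n−1))·max|ΔU|`). Notation as there:
`e(t,t',U,n) = energyDensityTT' t t' U n`; `Φ(t,t',U) = hubbardTTPrimeFermionInteraction t t' U`;
`e_Φ(ω) = ω.meanEnergy Φ 1`; `K₂(ω) = e_{Φ(0,1,0)}(ω)`; `D(ω) = e_{Φ(0,0,1)}(ω)` (double occupancy per
site); `H_b` = `Real.binEntropy` (`2H_b(n/2) = s_max(n)`); "thermal torus limit at `(β, s, U)`" = a torus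
limit (`IsTorusLimitOfMixture`) of the canonical sector Gibbs states `e^{-βH_L(t,s,U)|_sec}/Z` on the
`(rectN n L, S^z = 0)` sectors (the tree's torus-limit thermal convention, `TorusSectorGibbsMixture`).

THE POINT. For a thermal torus limit `ω` at a point `(β, s, U)` of a cell and an anchor `(s₀, U₀)`,
linearity and the energy–entropy cap of the convention give
`e_{Φ(t,s₀,U₀)}(ω) = e_{Φ(t,s,U)}(ω) + (U₀ − U)·D(ω) + (s₀ − s)·K₂(ω)
 ≤ e(t,s,U,n) + 2H_b(n/2)/β + (U₀ − U)·D(ω) + (s₀ − s)·K₂(ω)`.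
Three monotone facts price the three state-free / state terms WITHOUT any data at the anchor, exactly as
at `T = 0`: `e(t,s,U,n) ≤ e(t,s,U₂,n)` for `U ≤ U₂` (`energyDensityTT'_mono_U`), so the TOP EDGE carries
the energy and the two top corners' `T = 0` caps and ground-state `K₂` words cap it by their tangents;
`D(ω) ≥ 0` for every mixture torus limit, so ABOVE the anchor row the `U`-displacement costs nothing, and
below it at most `(U₀ − U₁)` times a docc ceiling — at `T > 0` the kinematic `D ≤ n/2` of the convention
(`IsTorusLimitOfMixture.docc_le_half_density_of_sectorGibbs`) or a rectangle-uniform THERMAL docc word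
(the Hartree–Fock ceiling `(n/2)²` of the `T = 0` file is a ground-state fact and is NOT used here);
`K₂(ω)` is priced by the thermal kinematic row `|K₂| ≤ 16/π²` or a rectangle-uniform thermal window.

* §1 the `U`-segment above the anchor: `IsTorusLimitOfMixture.meanEnergy_anchor_le_of_upperCap_U_of_sectorGibbs`
  — for `0 ≤ U₀ ≤ U ≤ U₂` every thermal torus limit `ω` at `(β, s, U)` has
  `e_{Φ(t,s,U₀)}(ω) ≤ R + 2H_b(n/2)/β` as soon as `e(t,s,U₂,n) ≤ R`: ONE cap at the top of the segment
  books every thermal cap-class certificate at its bottom for the whole `(segment) × (T ≤ 1/β)`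
  (`forall_sectorGibbsLimit_U_segment_of_forall_cap_upperCap`).
* §2 word-free cell rule `IsTorusLimitOfMixture.meanEnergy_anchor₂_le_of_topCaps_kinematic_of_sectorGibbs`:
  rectangle `[s₁,s₂] × [U₁,U₂]` (`U₁ ≥ 0`), anchor row `U₀ ∈ [U₁,U₂]` (any `s₀`), caps `R₁`, `R₂` at the
  top corners `(s₁,U₂)`, `(s₂,U₂)`:
  `e_{Φ(t,s₀,U₀)}(ω) ≤ max (R₁ + (16/π²)(s₀ − s₁)) (R₂ + (16/π²)(s₂ − s₀)) + (U₀ − U₁)(n/2) + 2H_b(n/2)/β`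
  for every thermal torus limit in the cell; BOX ⇒ WORD on `(cell) × (T ≤ 1/β)`
  `forall_sectorGibbsLimit_tPrime_U_cell_of_forall_cap_topCaps_kinematic`.
* §3 word form (fixed `β`) `IsTorusLimitOfMixture.meanEnergy_anchor₂_le_of_topCorners_of_sectorGibbs`:
  ground-state ceiling word `A₁` at `(s₁,U₂)` and floor word `B₂` at `(s₂,U₂)` (they price the `T = 0`
  tangents along the top edge), rectangle-uniform THERMAL windows `K₂ ∈ [B_K, A_K]`, `D ∈ [B_D, A_D]` at
  `β`: `≤ max (R₁ + (s₀ − s₁)·max A₁ A_K) (R₂ − (s₂ − s₀)·min B₂ B_K) + (U₀ − U₁)·max A_D 0 + 2H_b(n/2)/β`;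
  BOX ⇒ WORD `forall_sectorGibbsLimit_tPrime_U_cell_of_forall_cap_topCorners`.
* §4 the `κ`-priced twins for words with explicit cap slack.

Against the one-anchor booking the top corners' certified caps replace the anchor cap plus its own
tangents, the `t'`-price drops from `32/π²` to `16/π²`, and with the anchor on the BOTTOM edge
(`U₀ = U₁`) the `U`-term vanishes altogether. HONEST FRAMING: bookkeeping of linearity, monotonicity in
`U`, `D ≥ 0`, the energy–entropy cap, the Hellmann–Feynman tangents and the kinematic rows; thermal words
do not move in `β`, so the temperature-range cells are the kinematic ones; no number is produced here,
every cap and word is a hypothesis to be discharged by a certified row, and nothing here bears on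
superconductivity by itself. Everything is PROVED; no definition, no named fact, no numerical input.
WHAT THIS IS NOT: no certificate, no phase sentence — transport lemmas only.

## Mathlib / tree search

REUSED: `InfVolFermionState.meanEnergy_hubbardTTPrime_affine`, `energyDensityTT'_mono_U`
(`HubbardNNNHoppingEnergyDensityMonotone`), `IsTorusLimitOfMixture.docc_nonneg`
(`HubbardOneBodyKinematicRows`), `IsTorusLimitOfMixture.docc_le_half_density_of_sectorGibbs`,
`…abs_meanEnergy_diagHop_le_of_sectorGibbs`, `…meanEnergy_hubbardTTPrime_le_energyDensityTT'_add_binEntropy_div`,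
`sectorGibbsWeightTT'_nonneg`, `sum_sectorGibbsWeightTT'`, `isNParticle_sectorGibbsVectorTT'`,
`star_sectorGibbsVectorTT'_dotProduct_self` (`TorusSectorGibbsMixture`),
`energyDensityTT'_le_of_upperBound_tPrime_kinematic`, `energyDensityTT'_sub_le_mul_of_forall_diagHop_le`,
`mul_le_energyDensityTT'_sub_of_forall_le_diagHop` (`HubbardTTPrimeDiagHopTransport` §5).
`lean search 'topCaps.*sectorGibbs|topCorners.*sectorGibbs|upperCap_U.*sectorGibbs|U_cell_of_forall_cap.*sectorGibbs'
--decl`: nothing — the thermal convention had the one-anchor joint rule only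
(`forall_sectorGibbsLimit_tPrime_U_box_of_forall_cap_kinematic`, `HubbardTTPrimeDoccTransportThermal` §4);
the `T = 0` statements mirrored here name by name (suffix `_of_sectorGibbs`) are
`HubbardTTPrimeFarCornerCapTransport` §1–§4 (seat `hubbard-box-p3`).

## References

* R. B. Israel, *Convexity in the Theory of Lattice Gases*, Princeton (1979), Lemma II.3.1 (energy–entropy
  balance of Gibbs states; finite-volume variational principle). [cite: Israel1979, Lemma II.3.1]
* T. Koma, H. Tasaki, J. Stat. Phys. 76 (1994) 745, §1 (joint concavity in the couplings; the conjugate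
  observables are supergradients; `∂E/∂U = ⟨D⟩ ≥ 0`). [cite: KomaTasaki1994, §1]
* R. B. Griffiths, Phys. Rev. 152 (1966) 240, §II (monotonicity of conjugate expectations in the
  coupling). [cite: Griffiths1966, §II]
* J. Wang et al., Phys. Rev. X 14 (2024) 031006, §III (a relaxation certificate constrains every state
  below an energy cap). [cite: WangEtAl2024, §III]
* E. H. Lieb, M. Loss, Duke Math. J. 71 (1993) 337, §8 Thm. 8.2 (`|K₂| ≤ 16/π²`).
  [cite: LiebLoss1993, §8, Theorem 8.2]
* D. Ruelle, *Statistical Mechanics: Rigorous Results* (1969), §3.4 (kinematic one-body rows of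
  translation-invariant states). [cite: Ruelle1969, §3.4]
-/

noncomputable section

namespace Literature.MathematicalPhysics.QuantumLattice

open Matrix Finset HubbardWave0 Literature.Probability.LatticeModels ThermodynamicLimit
open _root_.Filter
open scoped _root_.Topology ComplexOrder BigOperators

namespace InfVolFermionState

/-! ### §1 The `U`-segment above the anchor: one cap at the top books the whole segment, `T ≤ 1/β` -/

/-- **Thermal anchor energy on the `U`-segment above the anchor.** For `0 ≤ U₀ ≤ U ≤ U₂` (same `t`,
`s`, density `0 ≤ n < 2`, `β > 0`) and a certified cap `e(t,s,U₂,n) ≤ R` at the TOP of the segment, every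
thermal torus limit `ω` at `(β, s, U)` has `e_{Φ(t,s,U₀)}(ω) ≤ R + 2H_b(n/2)/β`
(`e_{Φ(t,s,U₀)}(ω) = e_{Φ(t,s,U)}(ω) + (U₀ − U)D(ω) ≤ e(t,s,U,n) + 2H_b(n/2)/β ≤ e(t,s,U₂,n) + 2H_b(n/2)/β`:
`D ≥ 0`, the energy–entropy cap, and `e` is non-decreasing in `U`). The `T > 0` twin of
`IsTorusLimitOf.meanEnergy_anchor_le_of_upperCap_U`.
[cite: Israel1979, Lemma II.3.1] [cite: KomaTasaki1994, §1] [cite: Griffiths1966, §II] -/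
theorem IsTorusLimitOfMixture.meanEnergy_anchor_le_of_upperCap_U_of_sectorGibbs (t s : ℝ)
    {U₀ U U₂ : ℝ} (hU₀ : 0 ≤ U₀) (h0U : U₀ ≤ U) (hU2 : U ≤ U₂) {n : ℝ} (hn0 : 0 ≤ n) (hn2 : n < 2)
    {β : ℝ} (hβ : 0 < β) {R : ℝ} (hR : energyDensityTT' t s U₂ n ≤ R)
    {ω : InfVolFermionState 2} {Ls : ℕ → ℕ}
    (h : ω.IsTorusLimitOfMixture (sectorGibbsCount n) (fun L => sectorGibbsWeightTT' β t s U n L)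
      (fun L => sectorGibbsVectorTT' t s U n L) Ls) (hLs : Tendsto Ls atTop atTop) :
    ω.meanEnergy (hubbardTTPrimeFermionInteraction t s U₀) 1 ≤ R + 2 * Real.binEntropy (n / 2) / β := by
  have hU : 0 ≤ U := hU₀.trans h0U
  have haff := ω.meanEnergy_hubbardTTPrime_affine t s U s U₀
  rw [sub_self, zero_mul, add_zero] at haff
  have hcap := h.meanEnergy_hubbardTTPrime_le_energyDensityTT'_add_binEntropy_div t s hU hn0 hn2 hβ hLs
  have hmono := energyDensityTT'_mono_U t s hn0 hn2 hU hU2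
  have hD0 := h.docc_nonneg hLs
  have hDterm := mul_le_mul_of_nonpos_left hD0 (sub_nonpos.2 h0U)
  rw [mul_zero] at hDterm
  rw [haff]
  linarith

/-- **BOX ⇒ WORD on the `(U-segment above the anchor) × (T ≤ 1/β)`.** A property `P` certified at
`(t, s, U₀)` (`U₀ ≥ 0`) for the thermal CAP CLASS — every torus limit along `Ls → ∞` of finite mixtures
(nonnegative weights summing to one, unit `rectN n L`-particle components) with `e_{Φ(t,s,U₀)}(ω) ≤ u`
(the hypothesis shape of `forall_sectorGibbsLimit_tPrime_U_box_of_forall_cap_kinematic`) — holds for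
every thermal torus limit at `(β', s, U)`, every `U ∈ [U₀, U₂]` and every `β' ≥ β`, as soon as
`e(t,s,U₂,n) + 2H_b(n/2)/β ≤ u`. The `T > 0` twin of `forall_groundState_U_segment_of_forall_cap_upperCap`.
[cite: WangEtAl2024, §III] [cite: Israel1979, Lemma II.3.1] [cite: KomaTasaki1994, §1] -/
theorem forall_sectorGibbsLimit_U_segment_of_forall_cap_upperCap (t s : ℝ) {U₀ U₂ : ℝ}
    (hU₀ : 0 ≤ U₀) {n : ℝ} (hn0 : 0 ≤ n) (hn2 : n < 2) {β : ℝ} (hβ : 0 < β) {u : ℝ}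
    (hu : energyDensityTT' t s U₂ n + 2 * Real.binEntropy (n / 2) / β ≤ u)
    {P : InfVolFermionState 2 → Prop}
    (hP : ∀ (ω : InfVolFermionState 2) (m : ℕ → ℕ) (p : ∀ L, Fin (m L) → ℝ)
      (ψ : ∀ L, Fin (m L) → Fock (Orb (FermionTorus 2 L))) (Ls : ℕ → ℕ),
      Tendsto Ls atTop atTop → (∀ L i, 0 ≤ p L i) → (∀ L, ∑ i, p L i = 1) →
      (∀ L i, IsNParticle (rectN n L) (ψ L i)) → (∀ L i, star (ψ L i) ⬝ᵥ ψ L i = 1) →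
      ω.IsTorusLimitOfMixture m p ψ Ls →
      ω.meanEnergy (hubbardTTPrimeFermionInteraction t s U₀) 1 ≤ u → P ω)
    {U : ℝ} (hUm : U ∈ Set.Icc U₀ U₂) {β' : ℝ} (hβ' : β ≤ β')
    {ω : InfVolFermionState 2} {Ls : ℕ → ℕ}
    (h : ω.IsTorusLimitOfMixture (sectorGibbsCount n) (fun L => sectorGibbsWeightTT' β' t s U n L)
      (fun L => sectorGibbsVectorTT' t s U n L) Ls) (hLs : Tendsto Ls atTop atTop) : P ω := by
  have hβ'0 : 0 < β' := hβ.trans_le hβ'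
  refine hP ω (sectorGibbsCount n) _ _ Ls hLs
    (fun L i => sectorGibbsWeightTT'_nonneg β' t s U n L i)
    (fun L => sum_sectorGibbsWeightTT' β' t s U hn0 hn2.le L)
    (fun L i => isNParticle_sectorGibbsVectorTT' t s U n L i)
    (fun L i => star_sectorGibbsVectorTT'_dotProduct_self t s U n L i) h ?_
  have hwin := h.meanEnergy_anchor_le_of_upperCap_U_of_sectorGibbs t s hU₀ hUm.1 hUm.2 hn0 hn2 hβ'0
    (le_refl (energyDensityTT' t s U₂ n)) hLs
  have hH : 0 ≤ 2 * Real.binEntropy (n / 2) :=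
    mul_nonneg zero_le_two (Real.binEntropy_nonneg (by linarith) (by linarith))
  have hent : 2 * Real.binEntropy (n / 2) / β' ≤ 2 * Real.binEntropy (n / 2) / β :=
    div_le_div_of_nonneg_left hH hβ hβ'
  linarith

/-! ### §2 The cell from its two TOP-CORNER caps (thermal kinematic `K₂` and `D` rows), `T ≤ 1/β` -/

/-- **Thermal cell rule, word-free.** Rectangle `[s₁,s₂] × [U₁,U₂]` with `U₁ ≥ 0`, density `0 ≤ n < 2`,
`β > 0`, anchor row `U₀ ∈ [U₁,U₂]` and any anchor abscissa `s₀`; caps `e(t,s₁,U₂,n) ≤ R₁`,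
`e(t,s₂,U₂,n) ≤ R₂` at the two TOP corners. Every thermal torus limit `ω` at `(β, s, U)`, `(s,U)` in the
rectangle, satisfies
`e_{Φ(t,s₀,U₀)}(ω) ≤ max (R₁ + (16/π²)(s₀ − s₁)) (R₂ + (16/π²)(s₂ − s₀)) + (U₀ − U₁)(n/2) + 2H_b(n/2)/β`
(top edge by monotonicity in `U` and kinematic cap transport along it, `(s₀ − s)K₂(ω) ≤ (16/π²)|s₀ − s|`,
`(U₀ − U)D(ω) ≤ 0` above the anchor row and `≤ (U₀ − U)(n/2)` below it, entropy price). With the anchor on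
the bottom edge the `U`-term vanishes. The `T > 0` twin of
`IsTorusLimitOf.meanEnergy_anchor₂_le_of_topCaps_kinematic` (whose ground-state docc ceiling `(n/2)²` is
replaced by the kinematic `n/2`).
[cite: Israel1979, Lemma II.3.1] [cite: KomaTasaki1994, §1] [cite: LiebLoss1993, §8, Theorem 8.2] [cite: Ruelle1969, §3.4] -/
theorem IsTorusLimitOfMixture.meanEnergy_anchor₂_le_of_topCaps_kinematic_of_sectorGibbs (t : ℝ)
    {s₁ s₂ U₁ U₂ s₀ U₀ s U : ℝ} (hU₁ : 0 ≤ U₁) (hU₀ : U₀ ∈ Set.Icc U₁ U₂) (hs : s ∈ Set.Icc s₁ s₂)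
    (hUm : U ∈ Set.Icc U₁ U₂) {n : ℝ} (hn0 : 0 ≤ n) (hn2 : n < 2) {β : ℝ} (hβ : 0 < β) {R₁ R₂ : ℝ}
    (hR₁ : energyDensityTT' t s₁ U₂ n ≤ R₁) (hR₂ : energyDensityTT' t s₂ U₂ n ≤ R₂)
    {ω : InfVolFermionState 2} {Ls : ℕ → ℕ}
    (h : ω.IsTorusLimitOfMixture (sectorGibbsCount n) (fun L => sectorGibbsWeightTT' β t s U n L)
      (fun L => sectorGibbsVectorTT' t s U n L) Ls) (hLs : Tendsto Ls atTop atTop) :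
    ω.meanEnergy (hubbardTTPrimeFermionInteraction t s₀ U₀) 1 ≤
      max (R₁ + 16 / Real.pi ^ 2 * (s₀ - s₁)) (R₂ + 16 / Real.pi ^ 2 * (s₂ - s₀)) +
        (U₀ - U₁) * (n / 2) + 2 * Real.binEntropy (n / 2) / β := by
  have hU : 0 ≤ U := hU₁.trans hUm.1
  have hU₂ : 0 ≤ U₂ := hU.trans hUm.2
  have haff := ω.meanEnergy_hubbardTTPrime_affine t s U s₀ U₀
  have hcap := h.meanEnergy_hubbardTTPrime_le_energyDensityTT'_add_binEntropy_div t s hU hn0 hn2 hβ hLs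
  have hmono := energyDensityTT'_mono_U t s hn0 hn2 hU hUm.2
  have hK := abs_le.1 (h.abs_meanEnergy_diagHop_le_of_sectorGibbs t s U hn0 hn2 β hLs)
  have hD0 := h.docc_nonneg hLs
  have hDhi := h.docc_le_half_density_of_sectorGibbs t s U hn0 hn2.le β hLs
  set D := ω.meanEnergy (hubbardTTPrimeFermionInteraction 0 0 1) 1 with hD_def
  set K := ω.meanEnergy (hubbardTTPrimeFermionInteraction 0 1 0) 1 with hK_def
  set κ : ℝ := 16 / Real.pi ^ 2 with hκ_def
  -- the `U`-displacement term
  have hDterm : (U₀ - U) * D ≤ (U₀ - U₁) * (n / 2) := by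
    have hq : 0 ≤ n / 2 := by linarith
    rcases le_total U U₀ with hle | hge
    · have e₁ := mul_le_mul_of_nonneg_left hDhi (sub_nonneg.2 hle)
      have e₂ : (U₀ - U) * (n / 2) ≤ (U₀ - U₁) * (n / 2) :=
        mul_le_mul_of_nonneg_right (by linarith [hUm.1]) hq
      exact e₁.trans e₂
    · have e₁ := mul_le_mul_of_nonpos_left hD0 (sub_nonpos.2 hge)
      rw [mul_zero] at e₁
      exact e₁.trans (mul_nonneg (sub_nonneg.2 hU₀.1) hq)
  have hM₁ := le_max_left (R₁ + κ * (s₀ - s₁)) (R₂ + κ * (s₂ - s₀))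
  have hM₂ := le_max_right (R₁ + κ * (s₀ - s₁)) (R₂ + κ * (s₂ - s₀))
  rw [haff]
  rcases le_total s s₀ with hle | hge
  · -- left of the anchor: top-left corner
    have hc := energyDensityTT'_le_of_upperBound_tPrime_kinematic t hU₂ hn0 hn2 (s' := s) hR₁
    rw [abs_of_nonneg (sub_nonneg.2 hs.1)] at hc
    have hKt := mul_le_mul_of_nonneg_left hK.2 (sub_nonneg.2 hle)
    have e : R₁ + κ * (s₀ - s₁) = R₁ + κ * (s - s₁) + (s₀ - s) * κ := by ring
    linarith
  · -- right of the anchor: top-right corner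
    have hc := energyDensityTT'_le_of_upperBound_tPrime_kinematic t hU₂ hn0 hn2 (s' := s) hR₂
    rw [abs_of_nonpos (sub_nonpos.2 hs.2)] at hc
    have hKt := mul_le_mul_of_nonpos_left hK.1 (sub_nonpos.2 hge)
    have e : R₂ + κ * (s₂ - s₀) = R₂ + κ * (-(s - s₂)) + (s₀ - s) * (-κ) := by ring
    linarith

/-- **BOX ⇒ WORD on the `(cell) × (T ≤ 1/β)`, word-free.** Same rectangle and top-corner caps; a
property `P` certified at the anchor `(s₀, U₀)` (`U₀ ∈ [U₁,U₂]`, `U₁ ≥ 0`) for the thermal cap class with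
cap `u` holds for every thermal torus limit at `(β', s, U)`, every `(s,U)` in the rectangle and every
`β' ≥ β`, as soon as
`max (R₁ + (16/π²)(s₀ − s₁)) (R₂ + (16/π²)(s₂ − s₀)) + (U₀ − U₁)(n/2) + 2H_b(n/2)/β ≤ u` (against the
one-anchor `u₀ + 2H_b(n/2)/β + (32/π²)·max|Δs| + (n/2 − max(0,n−1))·max|ΔU|` of
`forall_sectorGibbsLimit_tPrime_U_box_of_forall_cap_kinematic`). The `T > 0` twin of
`forall_groundState_tPrime_U_cell_of_forall_cap_topCaps_kinematic`.
[cite: WangEtAl2024, §III] [cite: Israel1979, Lemma II.3.1] [cite: KomaTasaki1994, §1] -/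
theorem forall_sectorGibbsLimit_tPrime_U_cell_of_forall_cap_topCaps_kinematic (t : ℝ)
    {s₁ s₂ U₁ U₂ s₀ U₀ : ℝ} (hU₁ : 0 ≤ U₁) (hU₀ : U₀ ∈ Set.Icc U₁ U₂) {n : ℝ} (hn0 : 0 ≤ n)
    (hn2 : n < 2) {β : ℝ} (hβ : 0 < β) {R₁ R₂ u : ℝ}
    (hR₁ : energyDensityTT' t s₁ U₂ n ≤ R₁) (hR₂ : energyDensityTT' t s₂ U₂ n ≤ R₂)
    (hu : max (R₁ + 16 / Real.pi ^ 2 * (s₀ - s₁)) (R₂ + 16 / Real.pi ^ 2 * (s₂ - s₀)) +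
      (U₀ - U₁) * (n / 2) + 2 * Real.binEntropy (n / 2) / β ≤ u)
    {P : InfVolFermionState 2 → Prop}
    (hP : ∀ (ω : InfVolFermionState 2) (m : ℕ → ℕ) (p : ∀ L, Fin (m L) → ℝ)
      (ψ : ∀ L, Fin (m L) → Fock (Orb (FermionTorus 2 L))) (Ls : ℕ → ℕ),
      Tendsto Ls atTop atTop → (∀ L i, 0 ≤ p L i) → (∀ L, ∑ i, p L i = 1) →
      (∀ L i, IsNParticle (rectN n L) (ψ L i)) → (∀ L i, star (ψ L i) ⬝ᵥ ψ L i = 1) →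
      ω.IsTorusLimitOfMixture m p ψ Ls →
      ω.meanEnergy (hubbardTTPrimeFermionInteraction t s₀ U₀) 1 ≤ u → P ω)
    {s U : ℝ} (hs : s ∈ Set.Icc s₁ s₂) (hUm : U ∈ Set.Icc U₁ U₂) {β' : ℝ} (hβ' : β ≤ β')
    {ω : InfVolFermionState 2} {Ls : ℕ → ℕ}
    (h : ω.IsTorusLimitOfMixture (sectorGibbsCount n) (fun L => sectorGibbsWeightTT' β' t s U n L)
      (fun L => sectorGibbsVectorTT' t s U n L) Ls) (hLs : Tendsto Ls atTop atTop) : P ω := by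
  have hβ'0 : 0 < β' := hβ.trans_le hβ'
  refine hP ω (sectorGibbsCount n) _ _ Ls hLs
    (fun L i => sectorGibbsWeightTT'_nonneg β' t s U n L i)
    (fun L => sum_sectorGibbsWeightTT' β' t s U hn0 hn2.le L)
    (fun L i => isNParticle_sectorGibbsVectorTT' t s U n L i)
    (fun L i => star_sectorGibbsVectorTT'_dotProduct_self t s U n L i) h ?_
  have hwin := h.meanEnergy_anchor₂_le_of_topCaps_kinematic_of_sectorGibbs t (s₀ := s₀) hU₁ hU₀ hs
    hUm hn0 hn2 hβ'0 hR₁ hR₂ hLs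
  have hH : 0 ≤ 2 * Real.binEntropy (n / 2) :=
    mul_nonneg zero_le_two (Real.binEntropy_nonneg (by linarith) (by linarith))
  have hent : 2 * Real.binEntropy (n / 2) / β' ≤ 2 * Real.binEntropy (n / 2) / β :=
    div_le_div_of_nonneg_left hH hβ hβ'
  linarith

/-! ### §3 The cell from its two top corners' caps AND words, with rectangle-uniform thermal windows
(fixed `β`) -/

/-- **Thermal cell rule, word form.** Rectangle `[s₁,s₂] × [U₁,U₂]` (`U₁ ≥ 0`), density `0 ≤ n < 2`,
`β > 0`, anchor row `U₀ ∈ [U₁,U₂]`, any anchor abscissa `s₀`; at the top corners: caps `R₁` at `(s₁,U₂)`,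
`R₂` at `(s₂,U₂)`, a ground-state ceiling word `A₁` at `(s₁,U₂)` and a ground-state floor word `B₂` at
`(s₂,U₂)` (they price the `T = 0` tangents along the top edge); rectangle-uniform THERMAL windows at `β`,
`K₂ ∈ [B_K, A_K]` and `D ∈ [B_D, A_D]` for every thermal torus limit at every point of the rectangle.
Every thermal torus limit `ω` at `(β, s, U)`, `(s,U)` in the rectangle, satisfies
`e_{Φ(t,s₀,U₀)}(ω) ≤ max (R₁ + (s₀ − s₁)·max A₁ A_K) (R₂ − (s₂ − s₀)·min B₂ B_K) + (U₀ − U₁)·max A_D 0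
+ 2H_b(n/2)/β`. The `T > 0` twin of `IsTorusLimitOf.meanEnergy_anchor₂_le_of_topCorners`.
[cite: Israel1979, Lemma II.3.1] [cite: KomaTasaki1994, §1] [cite: Griffiths1966, §II] [cite: WangEtAl2024, §III] -/
theorem IsTorusLimitOfMixture.meanEnergy_anchor₂_le_of_topCorners_of_sectorGibbs (t : ℝ)
    {s₁ s₂ U₁ U₂ s₀ U₀ s U : ℝ} (hU₁ : 0 ≤ U₁) (hU₀ : U₀ ∈ Set.Icc U₁ U₂) (hs : s ∈ Set.Icc s₁ s₂)
    (hUm : U ∈ Set.Icc U₁ U₂) {n : ℝ} (hn0 : 0 ≤ n) (hn2 : n < 2) {β : ℝ} (hβ : 0 < β)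
    {R₁ R₂ A₁ B₂ AK BK AD BD : ℝ}
    (hR₁ : energyDensityTT' t s₁ U₂ n ≤ R₁) (hR₂ : energyDensityTT' t s₂ U₂ n ≤ R₂)
    (hA₁ : ∀ (ω₁ : InfVolFermionState 2) (Ls₁ : ℕ → ℕ) (ψ₁ : ∀ L, Fock (Orb (FermionTorus 2 L))),
      Tendsto Ls₁ atTop atTop →
      (∀ j, IsGroundStateInSector (hubbardTorusTT' (Ls₁ j) t s₁ U₂) (rectN n (Ls₁ j)) 0 (ψ₁ (Ls₁ j))) →
      (∀ j, star (ψ₁ (Ls₁ j)) ⬝ᵥ ψ₁ (Ls₁ j) = 1) → ω₁.IsTorusLimitOf ψ₁ Ls₁ →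
      ω₁.meanEnergy (hubbardTTPrimeFermionInteraction 0 1 0) 1 ≤ A₁)
    (hB₂ : ∀ (ω₂ : InfVolFermionState 2) (Ls₂ : ℕ → ℕ) (ψ₂ : ∀ L, Fock (Orb (FermionTorus 2 L))),
      Tendsto Ls₂ atTop atTop →
      (∀ j, IsGroundStateInSector (hubbardTorusTT' (Ls₂ j) t s₂ U₂) (rectN n (Ls₂ j)) 0 (ψ₂ (Ls₂ j))) →
      (∀ j, star (ψ₂ (Ls₂ j)) ⬝ᵥ ψ₂ (Ls₂ j) = 1) → ω₂.IsTorusLimitOf ψ₂ Ls₂ →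
      B₂ ≤ ω₂.meanEnergy (hubbardTTPrimeFermionInteraction 0 1 0) 1)
    (hK : ∀ (s' U' : ℝ), s' ∈ Set.Icc s₁ s₂ → U' ∈ Set.Icc U₁ U₂ →
      ∀ (ω' : InfVolFermionState 2) (Ls' : ℕ → ℕ), Tendsto Ls' atTop atTop →
      ω'.IsTorusLimitOfMixture (sectorGibbsCount n) (fun L => sectorGibbsWeightTT' β t s' U' n L)
        (fun L => sectorGibbsVectorTT' t s' U' n L) Ls' →
      ω'.meanEnergy (hubbardTTPrimeFermionInteraction 0 1 0) 1 ∈ Set.Icc BK AK)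
    (hD : ∀ (s' U' : ℝ), s' ∈ Set.Icc s₁ s₂ → U' ∈ Set.Icc U₁ U₂ →
      ∀ (ω' : InfVolFermionState 2) (Ls' : ℕ → ℕ), Tendsto Ls' atTop atTop →
      ω'.IsTorusLimitOfMixture (sectorGibbsCount n) (fun L => sectorGibbsWeightTT' β t s' U' n L)
        (fun L => sectorGibbsVectorTT' t s' U' n L) Ls' →
      ω'.meanEnergy (hubbardTTPrimeFermionInteraction 0 0 1) 1 ∈ Set.Icc BD AD)
    {ω : InfVolFermionState 2} {Ls : ℕ → ℕ}
    (h : ω.IsTorusLimitOfMixture (sectorGibbsCount n) (fun L => sectorGibbsWeightTT' β t s U n L)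
      (fun L => sectorGibbsVectorTT' t s U n L) Ls) (hLs : Tendsto Ls atTop atTop) :
    ω.meanEnergy (hubbardTTPrimeFermionInteraction t s₀ U₀) 1 ≤
      max (R₁ + (s₀ - s₁) * max A₁ AK) (R₂ - (s₂ - s₀) * min B₂ BK) + (U₀ - U₁) * max AD 0 +
        2 * Real.binEntropy (n / 2) / β := by
  have hU : 0 ≤ U := hU₁.trans hUm.1
  have hU₂ : 0 ≤ U₂ := hU.trans hUm.2
  have haff := ω.meanEnergy_hubbardTTPrime_affine t s U s₀ U₀
  have hcap := h.meanEnergy_hubbardTTPrime_le_energyDensityTT'_add_binEntropy_div t s hU hn0 hn2 hβ hLs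
  have hmono := energyDensityTT'_mono_U t s hn0 hn2 hU hUm.2
  have hKω := hK s U hs hUm ω Ls hLs h
  have hDω := hD s U hs hUm ω Ls hLs h
  have hD0 := h.docc_nonneg hLs
  set D := ω.meanEnergy (hubbardTTPrimeFermionInteraction 0 0 1) 1 with hD_def
  set K := ω.meanEnergy (hubbardTTPrimeFermionInteraction 0 1 0) 1 with hK_def
  -- the `U`-displacement term
  have hAD := le_max_left AD 0
  have hAD0 : 0 ≤ max AD 0 := le_max_right _ _
  have hDterm : (U₀ - U) * D ≤ (U₀ - U₁) * max AD 0 := by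
    rcases le_total U U₀ with hle | hge
    · have e₁ := mul_le_mul_of_nonneg_left (hDω.2.trans hAD) (sub_nonneg.2 hle)
      have e₂ : (U₀ - U) * max AD 0 ≤ (U₀ - U₁) * max AD 0 :=
        mul_le_mul_of_nonneg_right (by linarith [hUm.1]) hAD0
      exact e₁.trans e₂
    · have e₁ := mul_le_mul_of_nonpos_left hD0 (sub_nonpos.2 hge)
      rw [mul_zero] at e₁
      exact e₁.trans (mul_nonneg (sub_nonneg.2 hU₀.1) hAD0)
  have hM₁ := le_max_left (R₁ + (s₀ - s₁) * max A₁ AK) (R₂ - (s₂ - s₀) * min B₂ BK)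
  have hM₂ := le_max_right (R₁ + (s₀ - s₁) * max A₁ AK) (R₂ - (s₂ - s₀) * min B₂ BK)
  rw [haff]
  rcases le_total s s₀ with hle | hge
  · -- left of the anchor: top-left corner's tangent along the top edge, ceiling on `K₂`
    have hup := energyDensityTT'_sub_le_mul_of_forall_diagHop_le t (le_refl s₁) hs.1 hU₂ hn0 hn2 hA₁
    have e₁ : A₁ * (s - s₁) ≤ max A₁ AK * (s - s₁) :=
      mul_le_mul_of_nonneg_right (le_max_left _ _) (sub_nonneg.2 hs.1)
    have hKt := mul_le_mul_of_nonneg_left (hKω.2.trans (le_max_right A₁ AK)) (sub_nonneg.2 hle)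
    have e : R₁ + (s₀ - s₁) * max A₁ AK = R₁ + max A₁ AK * (s - s₁) + (s₀ - s) * max A₁ AK := by
      ring
    linarith
  · -- right of the anchor: top-right corner's tangent along the top edge, floor on `K₂`
    have hdn := mul_le_energyDensityTT'_sub_of_forall_le_diagHop t hs.2 (le_refl s₂) hU₂ hn0 hn2 hB₂
    have e₁ : min B₂ BK * (s₂ - s) ≤ B₂ * (s₂ - s) :=
      mul_le_mul_of_nonneg_right (min_le_left _ _) (sub_nonneg.2 hs.2)
    have hKt := mul_le_mul_of_nonpos_left ((min_le_right B₂ BK).trans hKω.1) (sub_nonpos.2 hge)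
    have e : R₂ - (s₂ - s₀) * min B₂ BK = R₂ - min B₂ BK * (s₂ - s) + (s₀ - s) * min B₂ BK := by
      ring
    linarith

/-- **BOX ⇒ WORD on the cell, word form (fixed `β`).** Same data; a thermal cap-class property `P`
certified at the anchor `(s₀, U₀)` for the cap `u` holds for every thermal torus limit at `(β, s, U)`,
every point of the rectangle, as soon as
`max (R₁ + (s₀ − s₁)·max A₁ A_K) (R₂ − (s₂ − s₀)·min B₂ B_K) + (U₀ − U₁)·max A_D 0 + 2H_b(n/2)/β ≤ u`.
The `T > 0` twin of `forall_groundState_tPrime_U_cell_of_forall_cap_topCorners`.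
[cite: WangEtAl2024, §III] [cite: Israel1979, Lemma II.3.1] [cite: KomaTasaki1994, §1] -/
theorem forall_sectorGibbsLimit_tPrime_U_cell_of_forall_cap_topCorners (t : ℝ)
    {s₁ s₂ U₁ U₂ s₀ U₀ : ℝ} (hU₁ : 0 ≤ U₁) (hU₀ : U₀ ∈ Set.Icc U₁ U₂) {n : ℝ} (hn0 : 0 ≤ n)
    (hn2 : n < 2) {β : ℝ} (hβ : 0 < β) {R₁ R₂ A₁ B₂ AK BK AD BD u : ℝ}
    (hR₁ : energyDensityTT' t s₁ U₂ n ≤ R₁) (hR₂ : energyDensityTT' t s₂ U₂ n ≤ R₂)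
    (hA₁ : ∀ (ω₁ : InfVolFermionState 2) (Ls₁ : ℕ → ℕ) (ψ₁ : ∀ L, Fock (Orb (FermionTorus 2 L))),
      Tendsto Ls₁ atTop atTop →
      (∀ j, IsGroundStateInSector (hubbardTorusTT' (Ls₁ j) t s₁ U₂) (rectN n (Ls₁ j)) 0 (ψ₁ (Ls₁ j))) →
      (∀ j, star (ψ₁ (Ls₁ j)) ⬝ᵥ ψ₁ (Ls₁ j) = 1) → ω₁.IsTorusLimitOf ψ₁ Ls₁ →
      ω₁.meanEnergy (hubbardTTPrimeFermionInteraction 0 1 0) 1 ≤ A₁)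
    (hB₂ : ∀ (ω₂ : InfVolFermionState 2) (Ls₂ : ℕ → ℕ) (ψ₂ : ∀ L, Fock (Orb (FermionTorus 2 L))),
      Tendsto Ls₂ atTop atTop →
      (∀ j, IsGroundStateInSector (hubbardTorusTT' (Ls₂ j) t s₂ U₂) (rectN n (Ls₂ j)) 0 (ψ₂ (Ls₂ j))) →
      (∀ j, star (ψ₂ (Ls₂ j)) ⬝ᵥ ψ₂ (Ls₂ j) = 1) → ω₂.IsTorusLimitOf ψ₂ Ls₂ →
      B₂ ≤ ω₂.meanEnergy (hubbardTTPrimeFermionInteraction 0 1 0) 1)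
    (hK : ∀ (s' U' : ℝ), s' ∈ Set.Icc s₁ s₂ → U' ∈ Set.Icc U₁ U₂ →
      ∀ (ω' : InfVolFermionState 2) (Ls' : ℕ → ℕ), Tendsto Ls' atTop atTop →
      ω'.IsTorusLimitOfMixture (sectorGibbsCount n) (fun L => sectorGibbsWeightTT' β t s' U' n L)
        (fun L => sectorGibbsVectorTT' t s' U' n L) Ls' →
      ω'.meanEnergy (hubbardTTPrimeFermionInteraction 0 1 0) 1 ∈ Set.Icc BK AK)
    (hD : ∀ (s' U' : ℝ), s' ∈ Set.Icc s₁ s₂ → U' ∈ Set.Icc U₁ U₂ →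
      ∀ (ω' : InfVolFermionState 2) (Ls' : ℕ → ℕ), Tendsto Ls' atTop atTop →
      ω'.IsTorusLimitOfMixture (sectorGibbsCount n) (fun L => sectorGibbsWeightTT' β t s' U' n L)
        (fun L => sectorGibbsVectorTT' t s' U' n L) Ls' →
      ω'.meanEnergy (hubbardTTPrimeFermionInteraction 0 0 1) 1 ∈ Set.Icc BD AD)
    (hu : max (R₁ + (s₀ - s₁) * max A₁ AK) (R₂ - (s₂ - s₀) * min B₂ BK) + (U₀ - U₁) * max AD 0 +
      2 * Real.binEntropy (n / 2) / β ≤ u)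
    {P : InfVolFermionState 2 → Prop}
    (hP : ∀ (ω : InfVolFermionState 2) (m : ℕ → ℕ) (p : ∀ L, Fin (m L) → ℝ)
      (ψ : ∀ L, Fin (m L) → Fock (Orb (FermionTorus 2 L))) (Ls : ℕ → ℕ),
      Tendsto Ls atTop atTop → (∀ L i, 0 ≤ p L i) → (∀ L, ∑ i, p L i = 1) →
      (∀ L i, IsNParticle (rectN n L) (ψ L i)) → (∀ L i, star (ψ L i) ⬝ᵥ ψ L i = 1) →
      ω.IsTorusLimitOfMixture m p ψ Ls →
      ω.meanEnergy (hubbardTTPrimeFermionInteraction t s₀ U₀) 1 ≤ u → P ω)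
    {s U : ℝ} (hs : s ∈ Set.Icc s₁ s₂) (hUm : U ∈ Set.Icc U₁ U₂)
    {ω : InfVolFermionState 2} {Ls : ℕ → ℕ}
    (h : ω.IsTorusLimitOfMixture (sectorGibbsCount n) (fun L => sectorGibbsWeightTT' β t s U n L)
      (fun L => sectorGibbsVectorTT' t s U n L) Ls) (hLs : Tendsto Ls atTop atTop) : P ω :=
  hP ω (sectorGibbsCount n) _ _ Ls hLs
    (fun L i => sectorGibbsWeightTT'_nonneg β t s U n L i)
    (fun L => sum_sectorGibbsWeightTT' β t s U hn0 hn2.le L)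
    (fun L i => isNParticle_sectorGibbsVectorTT' t s U n L i)
    (fun L i => star_sectorGibbsVectorTT'_dotProduct_self t s U n L i) h
    ((h.meanEnergy_anchor₂_le_of_topCorners_of_sectorGibbs t hU₁ hU₀ hs hUm hn0 hn2 hβ hR₁ hR₂ hA₁ hB₂
      hK hD hLs).trans hu)

/-! ### §4 Cap-class WORDS with explicit cap slack on the cell at `T > 0` (the `κ`-priced twins) -/

/-- **A κ-priced thermal word on the `(U-segment above the anchor) × (T ≤ 1/β)`.** For
`0 ≤ U₀ ≤ U ≤ U₂`, a cap `R` at `(s, U₂)` and a real word certified at the anchor `(s, U₀)` for the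
thermal cap class with its cap slack explicit, `c + κ·(u₀ − e_{Φ(t,s,U₀)}(ω)) ≤ f ω` (`κ ≥ 0`): every
thermal torus limit `ω` at `(β', s, U)`, `β' ≥ β`, has `c − κ·(R + 2H_b(n/2)/β − u₀) ≤ f ω`.
[cite: WangEtAl2024, §III] [cite: Israel1979, Lemma II.3.1] [cite: KomaTasaki1994, §1] -/
theorem IsTorusLimitOfMixture.sub_mul_le_word_of_forall_capSlack_upperCap_U_of_sectorGibbs (t s : ℝ)
    {U₀ U U₂ : ℝ} (hU₀ : 0 ≤ U₀) (h0U : U₀ ≤ U) (hU2 : U ≤ U₂) {n : ℝ} (hn0 : 0 ≤ n) (hn2 : n < 2)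
    {β : ℝ} (hβ : 0 < β) {R u₀ κ c : ℝ} (hκ : 0 ≤ κ) (hR : energyDensityTT' t s U₂ n ≤ R)
    {f : InfVolFermionState 2 → ℝ}
    (hf : ∀ (ω : InfVolFermionState 2) (m : ℕ → ℕ) (p : ∀ L, Fin (m L) → ℝ)
      (ψ : ∀ L, Fin (m L) → Fock (Orb (FermionTorus 2 L))) (Ls : ℕ → ℕ),
      Tendsto Ls atTop atTop → (∀ L i, 0 ≤ p L i) → (∀ L, ∑ i, p L i = 1) →
      (∀ L i, IsNParticle (rectN n L) (ψ L i)) → (∀ L i, star (ψ L i) ⬝ᵥ ψ L i = 1) →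
      ω.IsTorusLimitOfMixture m p ψ Ls →
      c + κ * (u₀ - ω.meanEnergy (hubbardTTPrimeFermionInteraction t s U₀) 1) ≤ f ω)
    {β' : ℝ} (hβ' : β ≤ β') {ω : InfVolFermionState 2} {Ls : ℕ → ℕ}
    (h : ω.IsTorusLimitOfMixture (sectorGibbsCount n) (fun L => sectorGibbsWeightTT' β' t s U n L)
      (fun L => sectorGibbsVectorTT' t s U n L) Ls) (hLs : Tendsto Ls atTop atTop) :
    c - κ * (R + 2 * Real.binEntropy (n / 2) / β - u₀) ≤ f ω := by
  have hβ'0 : 0 < β' := hβ.trans_le hβ'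
  have hfω := hf ω (sectorGibbsCount n) _ _ Ls hLs
    (fun L i => sectorGibbsWeightTT'_nonneg β' t s U n L i)
    (fun L => sum_sectorGibbsWeightTT' β' t s U hn0 hn2.le L)
    (fun L i => isNParticle_sectorGibbsVectorTT' t s U n L i)
    (fun L i => star_sectorGibbsVectorTT'_dotProduct_self t s U n L i) h
  have hcap := h.meanEnergy_anchor_le_of_upperCap_U_of_sectorGibbs t s hU₀ h0U hU2 hn0 hn2 hβ'0 hR hLs
  have hH : 0 ≤ 2 * Real.binEntropy (n / 2) :=
    mul_nonneg zero_le_two (Real.binEntropy_nonneg (by linarith) (by linarith))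
  have hent : 2 * Real.binEntropy (n / 2) / β' ≤ 2 * Real.binEntropy (n / 2) / β :=
    div_le_div_of_nonneg_left hH hβ hβ'
  have hslack : -(R + 2 * Real.binEntropy (n / 2) / β - u₀) ≤
      u₀ - ω.meanEnergy (hubbardTTPrimeFermionInteraction t s U₀) 1 := by linarith
  have hκs := mul_le_mul_of_nonneg_left hslack hκ
  linarith

/-- **A κ-priced thermal word on the `(cell) × (T ≤ 1/β)` from the top-corner caps (kinematic).**
Rectangle `[s₁,s₂] × [U₁,U₂]` (`U₁ ≥ 0`), anchor `(s₀, U₀)` with `U₀ ∈ [U₁,U₂]`, caps `R₁`, `R₂` at the top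
corners, a word `c + κ·(u₀ − e_{Φ(t,s₀,U₀)}(ω)) ≤ f ω` certified at the anchor for the thermal cap class
(`κ ≥ 0`): every thermal torus limit `ω` at `(β', s, U)`, `(s,U)` in the rectangle, `β' ≥ β`, has
`c − κ·(max (R₁ + (16/π²)(s₀ − s₁)) (R₂ + (16/π²)(s₂ − s₀)) + (U₀ − U₁)(n/2) + 2H_b(n/2)/β − u₀) ≤ f ω` —
the certified word is LIPSCHITZ in the cell data with constants `κ·16/π²` per unit of `t'`, `κ·n/2` per
unit of `U` below the anchor row (zero above it) and `κ·s_max(n)` per unit of `T`.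
[cite: WangEtAl2024, §III] [cite: Israel1979, Lemma II.3.1] [cite: LiebLoss1993, §8, Theorem 8.2] -/
theorem IsTorusLimitOfMixture.sub_mul_le_word_of_forall_capSlack_topCaps_kinematic_of_sectorGibbs
    (t : ℝ) {s₁ s₂ U₁ U₂ s₀ U₀ s U : ℝ} (hU₁ : 0 ≤ U₁) (hU₀ : U₀ ∈ Set.Icc U₁ U₂)
    (hs : s ∈ Set.Icc s₁ s₂) (hUm : U ∈ Set.Icc U₁ U₂) {n : ℝ} (hn0 : 0 ≤ n) (hn2 : n < 2)
    {β : ℝ} (hβ : 0 < β) {R₁ R₂ u₀ κ c : ℝ} (hκ : 0 ≤ κ)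
    (hR₁ : energyDensityTT' t s₁ U₂ n ≤ R₁) (hR₂ : energyDensityTT' t s₂ U₂ n ≤ R₂)
    {f : InfVolFermionState 2 → ℝ}
    (hf : ∀ (ω : InfVolFermionState 2) (m : ℕ → ℕ) (p : ∀ L, Fin (m L) → ℝ)
      (ψ : ∀ L, Fin (m L) → Fock (Orb (FermionTorus 2 L))) (Ls : ℕ → ℕ),
      Tendsto Ls atTop atTop → (∀ L i, 0 ≤ p L i) → (∀ L, ∑ i, p L i = 1) →
      (∀ L i, IsNParticle (rectN n L) (ψ L i)) → (∀ L i, star (ψ L i) ⬝ᵥ ψ L i = 1) →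
      ω.IsTorusLimitOfMixture m p ψ Ls →
      c + κ * (u₀ - ω.meanEnergy (hubbardTTPrimeFermionInteraction t s₀ U₀) 1) ≤ f ω)
    {β' : ℝ} (hβ' : β ≤ β') {ω : InfVolFermionState 2} {Ls : ℕ → ℕ}
    (h : ω.IsTorusLimitOfMixture (sectorGibbsCount n) (fun L => sectorGibbsWeightTT' β' t s U n L)
      (fun L => sectorGibbsVectorTT' t s U n L) Ls) (hLs : Tendsto Ls atTop atTop) :
    c - κ * (max (R₁ + 16 / Real.pi ^ 2 * (s₀ - s₁)) (R₂ + 16 / Real.pi ^ 2 * (s₂ - s₀)) +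
      (U₀ - U₁) * (n / 2) + 2 * Real.binEntropy (n / 2) / β - u₀) ≤ f ω := by
  have hβ'0 : 0 < β' := hβ.trans_le hβ'
  have hfω := hf ω (sectorGibbsCount n) _ _ Ls hLs
    (fun L i => sectorGibbsWeightTT'_nonneg β' t s U n L i)
    (fun L => sum_sectorGibbsWeightTT' β' t s U hn0 hn2.le L)
    (fun L i => isNParticle_sectorGibbsVectorTT' t s U n L i)
    (fun L i => star_sectorGibbsVectorTT'_dotProduct_self t s U n L i) h
  have hcap := h.meanEnergy_anchor₂_le_of_topCaps_kinematic_of_sectorGibbs t (s₀ := s₀) hU₁ hU₀ hs hUm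
    hn0 hn2 hβ'0 hR₁ hR₂ hLs
  have hH : 0 ≤ 2 * Real.binEntropy (n / 2) :=
    mul_nonneg zero_le_two (Real.binEntropy_nonneg (by linarith) (by linarith))
  have hent : 2 * Real.binEntropy (n / 2) / β' ≤ 2 * Real.binEntropy (n / 2) / β :=
    div_le_div_of_nonneg_left hH hβ hβ'
  have hslack : -(max (R₁ + 16 / Real.pi ^ 2 * (s₀ - s₁)) (R₂ + 16 / Real.pi ^ 2 * (s₂ - s₀)) +
      (U₀ - U₁) * (n / 2) + 2 * Real.binEntropy (n / 2) / β - u₀) ≤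
      u₀ - ω.meanEnergy (hubbardTTPrimeFermionInteraction t s₀ U₀) 1 := by linarith
  have hκs := mul_le_mul_of_nonneg_left hslack hκ
  linarith

/-- **A κ-priced thermal word on the cell from the top corners' caps and words (rectangle-uniform
thermal windows, fixed `β`).** Same data as
`IsTorusLimitOfMixture.meanEnergy_anchor₂_le_of_topCorners_of_sectorGibbs` plus the certified word with
explicit slack at the anchor: every thermal torus limit `ω` at `(β, s, U)`, `(s,U)` in the rectangle, has
`c − κ·(max (R₁ + (s₀ − s₁)·max A₁ A_K) (R₂ − (s₂ − s₀)·min B₂ B_K) + (U₀ − U₁)·max A_D 0 + 2H_b(n/2)/β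
− u₀) ≤ f ω`. [cite: WangEtAl2024, §III] [cite: Israel1979, Lemma II.3.1] [cite: KomaTasaki1994, §1] -/
theorem IsTorusLimitOfMixture.sub_mul_le_word_of_forall_capSlack_topCorners_of_sectorGibbs (t : ℝ)
    {s₁ s₂ U₁ U₂ s₀ U₀ s U : ℝ} (hU₁ : 0 ≤ U₁) (hU₀ : U₀ ∈ Set.Icc U₁ U₂) (hs : s ∈ Set.Icc s₁ s₂)
    (hUm : U ∈ Set.Icc U₁ U₂) {n : ℝ} (hn0 : 0 ≤ n) (hn2 : n < 2) {β : ℝ} (hβ : 0 < β)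
    {R₁ R₂ A₁ B₂ AK BK AD BD u₀ κ c : ℝ} (hκ : 0 ≤ κ)
    (hR₁ : energyDensityTT' t s₁ U₂ n ≤ R₁) (hR₂ : energyDensityTT' t s₂ U₂ n ≤ R₂)
    (hA₁ : ∀ (ω₁ : InfVolFermionState 2) (Ls₁ : ℕ → ℕ) (ψ₁ : ∀ L, Fock (Orb (FermionTorus 2 L))),
      Tendsto Ls₁ atTop atTop →
      (∀ j, IsGroundStateInSector (hubbardTorusTT' (Ls₁ j) t s₁ U₂) (rectN n (Ls₁ j)) 0 (ψ₁ (Ls₁ j))) →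
      (∀ j, star (ψ₁ (Ls₁ j)) ⬝ᵥ ψ₁ (Ls₁ j) = 1) → ω₁.IsTorusLimitOf ψ₁ Ls₁ →
      ω₁.meanEnergy (hubbardTTPrimeFermionInteraction 0 1 0) 1 ≤ A₁)
    (hB₂ : ∀ (ω₂ : InfVolFermionState 2) (Ls₂ : ℕ → ℕ) (ψ₂ : ∀ L, Fock (Orb (FermionTorus 2 L))),
      Tendsto Ls₂ atTop atTop →
      (∀ j, IsGroundStateInSector (hubbardTorusTT' (Ls₂ j) t s₂ U₂) (rectN n (Ls₂ j)) 0 (ψ₂ (Ls₂ j))) →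
      (∀ j, star (ψ₂ (Ls₂ j)) ⬝ᵥ ψ₂ (Ls₂ j) = 1) → ω₂.IsTorusLimitOf ψ₂ Ls₂ →
      B₂ ≤ ω₂.meanEnergy (hubbardTTPrimeFermionInteraction 0 1 0) 1)
    (hK : ∀ (s' U' : ℝ), s' ∈ Set.Icc s₁ s₂ → U' ∈ Set.Icc U₁ U₂ →
      ∀ (ω' : InfVolFermionState 2) (Ls' : ℕ → ℕ), Tendsto Ls' atTop atTop →
      ω'.IsTorusLimitOfMixture (sectorGibbsCount n) (fun L => sectorGibbsWeightTT' β t s' U' n L)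
        (fun L => sectorGibbsVectorTT' t s' U' n L) Ls' →
      ω'.meanEnergy (hubbardTTPrimeFermionInteraction 0 1 0) 1 ∈ Set.Icc BK AK)
    (hD : ∀ (s' U' : ℝ), s' ∈ Set.Icc s₁ s₂ → U' ∈ Set.Icc U₁ U₂ →
      ∀ (ω' : InfVolFermionState 2) (Ls' : ℕ → ℕ), Tendsto Ls' atTop atTop →
      ω'.IsTorusLimitOfMixture (sectorGibbsCount n) (fun L => sectorGibbsWeightTT' β t s' U' n L)
        (fun L => sectorGibbsVectorTT' t s' U' n L) Ls' →
      ω'.meanEnergy (hubbardTTPrimeFermionInteraction 0 0 1) 1 ∈ Set.Icc BD AD)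
    {f : InfVolFermionState 2 → ℝ}
    (hf : ∀ (ω : InfVolFermionState 2) (m : ℕ → ℕ) (p : ∀ L, Fin (m L) → ℝ)
      (ψ : ∀ L, Fin (m L) → Fock (Orb (FermionTorus 2 L))) (Ls : ℕ → ℕ),
      Tendsto Ls atTop atTop → (∀ L i, 0 ≤ p L i) → (∀ L, ∑ i, p L i = 1) →
      (∀ L i, IsNParticle (rectN n L) (ψ L i)) → (∀ L i, star (ψ L i) ⬝ᵥ ψ L i = 1) →
      ω.IsTorusLimitOfMixture m p ψ Ls →
      c + κ * (u₀ - ω.meanEnergy (hubbardTTPrimeFermionInteraction t s₀ U₀) 1) ≤ f ω)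
    {ω : InfVolFermionState 2} {Ls : ℕ → ℕ}
    (h : ω.IsTorusLimitOfMixture (sectorGibbsCount n) (fun L => sectorGibbsWeightTT' β t s U n L)
      (fun L => sectorGibbsVectorTT' t s U n L) Ls) (hLs : Tendsto Ls atTop atTop) :
    c - κ * (max (R₁ + (s₀ - s₁) * max A₁ AK) (R₂ - (s₂ - s₀) * min B₂ BK) + (U₀ - U₁) * max AD 0 +
      2 * Real.binEntropy (n / 2) / β - u₀) ≤ f ω := by
  have hfω := hf ω (sectorGibbsCount n) _ _ Ls hLs
    (fun L i => sectorGibbsWeightTT'_nonneg β t s U n L i)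
    (fun L => sum_sectorGibbsWeightTT' β t s U hn0 hn2.le L)
    (fun L i => isNParticle_sectorGibbsVectorTT' t s U n L i)
    (fun L i => star_sectorGibbsVectorTT'_dotProduct_self t s U n L i) h
  have hcap := h.meanEnergy_anchor₂_le_of_topCorners_of_sectorGibbs t (s₀ := s₀) hU₁ hU₀ hs hUm hn0
    hn2 hβ hR₁ hR₂ hA₁ hB₂ hK hD hLs
  have hslack : -(max (R₁ + (s₀ - s₁) * max A₁ AK) (R₂ - (s₂ - s₀) * min B₂ BK) +
      (U₀ - U₁) * max AD 0 + 2 * Real.binEntropy (n / 2) / β - u₀) ≤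
      u₀ - ω.meanEnergy (hubbardTTPrimeFermionInteraction t s₀ U₀) 1 := by linarith
  have hκs := mul_le_mul_of_nonneg_left hslack hκ
  linarith

end InfVolFermionState

end Literature.MathematicalPhysics.QuantumLattice

end
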